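import Literature.Analysis.FluidPDE.ElgindiL2Coercivity
import HarnessLib

/-!
# The commutation identity `L₁₂(𝓛_Γ f) = 𝓛(L₁₂ f)` of Elgindi ([Elgindi2021] Lemma 5.3, (L12L))

Topic `Literature/Analysis/FluidPDE`. Proof file (everything proved, no definitions, no named
facts) on the proof path of the named fact
`Literature.Analysis.FluidPDE.Elgindi.ElgindiGhoulMasmoudi2021_stabilityCore`
(`ElgindiStabilityDecomposition.lean`), completing Lemma 5.3 of T. M. Elgindi, Ann. of Math. 194
(2021) = arXiv:1904.04795 (`[Elgindi2021]`), §5, p. 15 of the held text, whose part (LW) is in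
`ElgindiLinearizedOperator.lean`:

> Lemma 5.3. `L₁₂(𝓛_Γ(f)) = 𝓛(L₁₂(f))` (L12L). Proof: "`L₁₂(𝓛_Γ(f)) = L₁₂(f + z∂_z f −
> 2f/(1+z) − (2zΓ(θ)/(c(1+z)²))L₁₂(f)) = L₁₂(f) + z∂_z L₁₂(f) − (2/(1+z))L₁₂(f)`."

Here `𝓛` acts on the radial function `L₁₂(f)` as `g ↦ g + zg' − 2g/(1+z)`. The identity is what
makes the codimension-one condition `L₁₂(f)(0) = 0` propagate (Elgindi–Ghoul–Masmoudi, Camb. J.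
Math. 9 (2021), §5 Prop. 5.1, which quotes "the identity `L₁₂𝓛_{F_*} = 𝓛L₁₂`"; at `z = 0` it reads
`L₁₂(𝓛_Γ f)(0) = −L₁₂(f)(0)`).

## The computation behind the printed one-liner

Two of the four terms are immediate (`L₁₂(f)`, and `L₁₂(z∂_z f) = z∂_zL₁₂(f)` =
`Elgindi.L12_Dz_eq_mul_deriv`). The remaining two are *not* termwise equal to `−2L₁₂(f)/(1+z)`:
`L₁₂(2f/(1+z))(z) = ∫_z^∞ 2φ(r)/(r(1+r)) dr` (`φ = ∫K f dθ`) and, since `∫₀^{π/2}ΓK = c`,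
`L₁₂((2zΓ/(c(1+z)²))L₁₂f)(z) = ∫_z^∞ 2L₁₂(f)(r)/(1+r)² dr`; their sum is `∫_z^∞ −B'(r) dr =
B(z)` for `B = 2L₁₂(f)/(1+z)` (using `(L₁₂f)' = −φ/z`, `ElgindiL12Calculus.lean`), i.e.
`2L₁₂(f)(z)/(1+z)`. This file proves exactly this, for `f ∈ C¹` compactly supported inside the
open strip, `α ≥ 0` (so that `c > 0`) and every `z ≥ 0`.

## Contents

* `L12_eq_setIntegral_prod`: Fubini at level `z`, `L₁₂(g)(z) = ∬_{(z,∞)×(0,π/2)} g K/r`;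
* `L12_opLΓ` (**(L12L)**): `L₁₂(𝓛_Γ f)(z) = L₁₂(f)(z) + z(L₁₂f)'(z) − 2L₁₂(f)(z)/(1+z)`, `z ≥ 0`;
* `L12_opLΓ_zero`: at `z = 0`, `L₁₂(𝓛_Γ f)(0) = −L₁₂(f)(0)`.

Used from Mathlib: `setIntegral_prod`, `Integrable.mul_prod`, `integral_Ioi_of_hasDerivAt_of_tendsto`,
`IntegrableOn.of_forall_sdiff_eq_zero`.
-/

noncomputable section

open MeasureTheory Set Function Real Filter
open _root_.Topology

namespace Literature.Analysis.FluidPDE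

namespace Elgindi

/-! ### Fubini for `L₁₂` at level `z` -/

/-- **`L₁₂(g)(z) = ∬_{(z,∞)×(0,π/2)} g(r,θ)K(θ)/r dr dθ`** whenever the integrand is integrable on
that product set (Fubini; the level-`z` version of `L12_zero_eq_setIntegral`). [folklore] -/
theorem L12_eq_setIntegral_prod {g : ℝ → ℝ → ℝ} {z : ℝ}
    (hg : IntegrableOn (l12Integrand g) (Ioi z ×ˢ Ioo 0 (π / 2))) :
    L12 g z = ∫ p in Ioi z ×ˢ Ioo 0 (π / 2), l12Integrand g p := by
  rw [L12_def, Measure.volume_eq_prod, setIntegral_prod _ (by rw [← Measure.volume_eq_prod]; exact hg)]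
  rfl

/-! ### (L12L) -/

/-- **Lemma 5.3, (L12L): `L₁₂(𝓛_Γ f) = 𝓛(L₁₂ f)`**, i.e.
`L₁₂(𝓛_Γ f)(z) = L₁₂(f)(z) + z(L₁₂f)'(z) − 2L₁₂(f)(z)/(1+z)` for every `z ≥ 0`, for `f ∈ C¹`
compactly supported inside the open quarter strip and `α ≥ 0` (Elgindi 2021, Lemma 5.3:
"`L₁₂(𝓛_Γ(f)) = L₁₂(f + z∂_z f − 2f/(1+z) − (2zΓ(θ)/(c(1+z)²))L₁₂(f)) = L₁₂(f) + z∂_zL₁₂(f) −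
(2/(1+z))L₁₂(f)`"; quoted as "the identity `L₁₂𝓛_{F_*} = 𝓛L₁₂`" in Elgindi–Ghoul–Masmoudi 2021,
§5). See the module docstring for the computation of the last two terms. [cite: Elgindi2021, §5 Lemma 5.3 (L12L) (p. 15 of arXiv:1904.04795)]
[cite: ElgindiGhoulMasmoudi2021, §5 Proposition 5.1, proof (p. 13 of arXiv:1910.14071): the identity L₁₂𝓛_{F_*} = 𝓛L₁₂] -/
theorem L12_opLΓ {α : ℝ} (hα : 0 ≤ α) {f : ℝ → ℝ → ℝ} (hf : ContDiff ℝ 1 (uncurry f))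
    (hs : HasCompactSupport (uncurry f)) (hsub : tsupport (uncurry f) ⊆ strip) {z : ℝ} (hz : 0 ≤ z) :
    L12 (opLΓ α f) z = L12 f z + z * deriv (L12 f) z - 2 * L12 f z / (1 + z) := by
  -- notation and basic facts
  set c : ℝ := profileConst α with hc
  have hcpos : 0 < c := profileConst_pos hα
  set L : ℝ → ℝ := L12 f with hLdef
  set ψ : ℝ → ℝ := fun r => kMoment f r / r with hψ
  have hfc : Continuous (uncurry f) := hf.continuous
  obtain ⟨a, b, ha, -, hfab⟩ := exists_radial_bounds' hs hsub
  have hf0 : ∀ p : ℝ × ℝ, p ∉ tsupport (uncurry f) → f p.1 p.2 = 0 := fun p hp =>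
    (image_eq_zero_of_notMem_tsupport hp : uncurry f p = 0)
  have hLb : ∀ r, b < r → L r = 0 := fun r hr => L12_eq_zero_of_le hfc ha hfab hr.le
  have hLd : ∀ r, HasDerivAt L (-ψ r) r := hasDerivAt_L12 hfc hs hsub
  have hψc : Continuous ψ := continuous_kMoment_div hfc ha hfab
  have hLc : Continuous L := continuous_L12 hfc hs hsub
  have hψb : ∀ r, b < r → ψ r = 0 := fun r hr => by
    simp [hψ, kMoment_eq_zero_of_not_mem hfab (Or.inr hr)]
  have hKcl : IsClosed (tsupport (uncurry f)) := isClosed_tsupport _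
  set E : Set (ℝ × ℝ) := Ioi z ×ˢ Ioo 0 (π / 2) with hE
  have hEs : E ⊆ strip := prod_mono (Ioi_subset_Ioi hz) Subset.rfl
  have hEm : MeasurableSet E := measurableSet_Ioi.prod measurableSet_Ioo
  -- the four integrands
  set I₁ : ℝ × ℝ → ℝ := l12Integrand f with hI₁
  set I₂ : ℝ × ℝ → ℝ := l12Integrand (Dz f) with hI₂
  set I₃ : ℝ × ℝ → ℝ := l12Integrand fun r θ => 2 * f r θ / (1 + r) with hI₃
  set I₄ : ℝ × ℝ → ℝ := l12Integrand fun r θ =>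
    2 * r * angularWeight α θ / (c * (1 + r) ^ 2) * L r with hI₄
  have hsplit : ∀ p, l12Integrand (opLΓ α f) p = I₁ p + I₂ p - I₃ p - I₄ p := by
    intro p
    simp only [hI₁, hI₂, hI₃, hI₄, l12Integrand_apply, opLΓ_apply, opL_apply]
    ring
  -- `I₁, I₂, I₃` are continuous with compact support (zero off `tsupport f`)
  have hKon : ContinuousOn (fun p : ℝ × ℝ => kernelK p.2 / p.1) strip :=
    (continuous_kernelK.comp continuous_snd).continuousOn.div continuousOn_fst fun p hp => ne_of_gt hp.1
  have hfon : ContinuousOn (fun p : ℝ × ℝ => f p.1 p.2) strip := hfc.continuousOn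
  have cI₁ : Continuous I₁ := by
    refine continuous_of_continuousOn_strip hKcl hsub ?_ fun p hp => by simp [hI₁, hf0 p hp]
    simp only [hI₁]
    change ContinuousOn (fun p : ℝ × ℝ => f p.1 p.2 * kernelK p.2 / p.1) strip
    exact (hfon.mul (continuous_kernelK.comp continuous_snd).continuousOn).div continuousOn_fst
      fun p hp => ne_of_gt hp.1
  have hdz0 : ∀ p : ℝ × ℝ, p ∉ tsupport (uncurry f) → Dz f p.1 p.2 = 0 := by
    intro p hp
    have : dz f p.1 p.2 = 0 := deriv_slice_fst_eq_zero_of_notMem_tsupport (F := uncurry f) hp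
    rw [Dz_eq_mul_dz, this, mul_zero]
  have cI₂ : Continuous I₂ := by
    refine continuous_of_continuousOn_strip hKcl hsub ?_ fun p hp => by simp [hI₂, hdz0 p hp]
    simp only [hI₂]
    change ContinuousOn (fun p : ℝ × ℝ => Dz f p.1 p.2 * kernelK p.2 / p.1) strip
    have hD : ContinuousOn (fun p : ℝ × ℝ => Dz f p.1 p.2) strip :=
      (continuous_fst.mul (continuous_dz hf)).continuousOn
    exact (hD.mul (continuous_kernelK.comp continuous_snd).continuousOn).div continuousOn_fst
      fun p hp => ne_of_gt hp.1
  have cI₃ : Continuous I₃ := by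
    refine continuous_of_continuousOn_strip hKcl hsub ?_ fun p hp => by simp [hI₃, hf0 p hp]
    simp only [hI₃]
    change ContinuousOn (fun p : ℝ × ℝ => 2 * f p.1 p.2 / (1 + p.1) * kernelK p.2 / p.1) strip
    have h3 : ContinuousOn (fun p : ℝ × ℝ => 2 * f p.1 p.2 / (1 + p.1)) strip :=
      (continuousOn_const.mul hfon).div (by fun_prop) fun p hp => by
        have : (0 : ℝ) < p.1 := hp.1; positivity
    exact (h3.mul (continuous_kernelK.comp continuous_snd).continuousOn).div continuousOn_fst
      fun p hp => ne_of_gt hp.1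
  have sI₁ : HasCompactSupport I₁ := HasCompactSupport.intro hs fun p hp => by simp [hI₁, hf0 p hp]
  have sI₂ : HasCompactSupport I₂ := HasCompactSupport.intro hs fun p hp => by simp [hI₂, hdz0 p hp]
  have sI₃ : HasCompactSupport I₃ := HasCompactSupport.intro hs fun p hp => by simp [hI₃, hf0 p hp]
  have iI₁ : IntegrableOn I₁ E := (cI₁.integrable_of_hasCompactSupport sI₁).integrableOn
  have iI₂ : IntegrableOn I₂ E := (cI₂.integrable_of_hasCompactSupport sI₂).integrableOn
  have iI₃ : IntegrableOn I₃ E := (cI₃.integrable_of_hasCompactSupport sI₃).integrableOn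
  -- `I₄ = ℓ(r) m(θ)` on `E`, with `ℓ = 2L/(c(1+r)²)` integrable on `(z, ∞)` and `m = ΓK`
  set ℓ : ℝ → ℝ := fun r => 2 * L r / (c * (1 + r) ^ 2) with hℓ
  have hℓc : ContinuousOn ℓ (Ici z) := by
    refine (continuousOn_const.mul hLc.continuousOn).div (by fun_prop) fun r hr => ?_
    have : (0 : ℝ) ≤ r := hz.trans hr
    positivity
  have hℓ0 : ∀ r, b < r → ℓ r = 0 := fun r hr => by simp [hℓ, hLb r hr]
  have iℓ : IntegrableOn ℓ (Ioi z) := by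
    have h1 : IntegrableOn ℓ (Icc z (max z b)) := hℓc.mono Icc_subset_Ici_self |>.integrableOn_compact
      isCompact_Icc
    refine h1.of_forall_sdiff_eq_zero measurableSet_Ioi fun r hr => hℓ0 r ?_
    simp only [Set.mem_sdiff, mem_Ioi, mem_Icc, not_and, not_le] at hr
    exact lt_of_le_of_lt (le_max_right _ _) (hr.2 hr.1.le)
  have im : IntegrableOn (fun θ => angularWeight α θ * kernelK θ) (Ioo 0 (π / 2)) :=
    (((continuous_angularWeight hα).mul continuous_kernelK).integrableOn_Icc (a := 0)
      (b := π / 2)).mono_set Ioo_subset_Icc_self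
  have iI₄ : IntegrableOn I₄ E := by
    have h := iℓ.mul_prod im
    rw [Measure.prod_restrict, ← Measure.volume_eq_prod] at h
    have h' : IntegrableOn (fun p : ℝ × ℝ => ℓ p.1 * (angularWeight α p.2 * kernelK p.2)) E := h
    refine h'.congr_fun (fun p hp => ?_) hEm
    have hr : (0 : ℝ) < p.1 := hz.trans_lt hp.1
    simp only [hI₄, hℓ, l12Integrand_apply]
    field_simp
  -- Step 1: split `L₁₂(𝓛_Γ f)(z)` into the four double integrals
  have step1 : L12 (opLΓ α f) z =
      (∫ p in E, I₁ p) + (∫ p in E, I₂ p) - (∫ p in E, I₃ p) - ∫ p in E, I₄ p := by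
    have hInt : IntegrableOn (l12Integrand (opLΓ α f)) E := by
      have := ((iI₁.add iI₂).sub iI₃).sub iI₄
      exact this.congr_fun (fun p _ => (hsplit p).symm) hEm
    rw [L12_eq_setIntegral_prod hInt, setIntegral_congr_fun hEm fun p _ => hsplit p,
      integral_sub, integral_sub, integral_add]
    all_goals first
      | exact iI₁
      | exact iI₂
      | exact iI₃
      | exact iI₄
      | exact iI₁.add iI₂
      | exact (iI₁.add iI₂).sub iI₃
  have e1 : ∫ p in E, I₁ p = L z := (L12_eq_setIntegral_prod iI₁).symm
  have e2 : ∫ p in E, I₂ p = z * deriv L z := by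
    rw [← L12_eq_setIntegral_prod iI₂]
    exact L12_Dz_eq_mul_deriv hf hs hsub z
  -- Step 2: the two remaining double integrals as one-variable integrals
  have e3 : ∫ p in E, I₃ p = ∫ r in Ioi z, 2 * ψ r / (1 + r) := by
    rw [hE, Measure.volume_eq_prod, setIntegral_prod _ (by rw [← Measure.volume_eq_prod]; exact iI₃)]
    refine setIntegral_congr_fun measurableSet_Ioi fun r hr => ?_
    have hr0 : (0 : ℝ) < r := hz.trans_lt hr
    have e : ∀ θ, I₃ (r, θ) = 2 / ((1 + r) * r) * (f r θ * kernelK θ) := fun θ => by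
      simp only [hI₃, l12Integrand_apply]
      field_simp
    simp_rw [e]
    rw [integral_const_mul, ← kMoment_def]
    simp only [hψ]
    field_simp
  have e4 : ∫ p in E, I₄ p = ∫ r in Ioi z, 2 * L r / (1 + r) ^ 2 := by
    rw [hE, Measure.volume_eq_prod, setIntegral_prod _ (by rw [← Measure.volume_eq_prod]; exact iI₄)]
    refine setIntegral_congr_fun measurableSet_Ioi fun r hr => ?_
    have hr0 : (0 : ℝ) < r := hz.trans_lt hr
    have e : ∀ θ, I₄ (r, θ) = ℓ r * (kernelK θ * angularWeight α θ) := fun θ => by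
      simp only [hI₄, hℓ, l12Integrand_apply]
      field_simp
    simp_rw [e]
    rw [integral_const_mul, ← profileConst_eq_setIntegral, ← hc]
    simp only [hℓ]
    field_simp
  -- Step 3: `∫_z^∞ (2ψ/(1+r) + 2L/(1+r)²) dr = 2L(z)/(1+z)` via `B = 2L/(1+r)`
  set B : ℝ → ℝ := fun r => 2 * L r / (1 + r) with hB
  set B' : ℝ → ℝ := fun r => -(2 * ψ r / (1 + r)) - 2 * L r / (1 + r) ^ 2 with hB'
  have hBd : ∀ r, -1 < r → HasDerivAt B (B' r) r := by
    intro r hr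
    have h1r : 1 + r ≠ 0 := by linarith
    have hden : HasDerivAt (fun r : ℝ => 1 + r) 1 r := by simpa using (hasDerivAt_id' r).const_add 1
    have h := ((hLd r).const_mul 2).div hden h1r
    refine h.congr_deriv ?_
    simp only [hB']
    field_simp
  have hB'c : ContinuousOn B' (Ioi (-1)) := by
    have h1 : ContinuousOn (fun r : ℝ => 1 + r) (Ioi (-1)) := by fun_prop
    have hne : ∀ r ∈ Ioi (-1 : ℝ), (1 : ℝ) + r ≠ 0 := fun r hr => by
      have : (-1 : ℝ) < r := hr; linarith
    refine ((((continuousOn_const.mul hψc.continuousOn).div h1 hne).neg).sub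
      ((continuousOn_const.mul hLc.continuousOn).div (h1.pow 2) fun r hr => pow_ne_zero 2 (hne r hr)))
  have hB'0 : ∀ r, b < r → B' r = 0 := fun r hr => by simp [hB', hLb r hr, hψb r hr]
  have iB' : IntegrableOn B' (Ioi z) := by
    have h1 : IntegrableOn B' (Icc z (max z b)) :=
      (hB'c.mono fun r hr => (show (-1 : ℝ) < r by have : z ≤ r := hr.1; linarith)).integrableOn_compact
        isCompact_Icc
    refine h1.of_forall_sdiff_eq_zero measurableSet_Ioi fun r hr => hB'0 r ?_
    simp only [Set.mem_sdiff, mem_Ioi, mem_Icc, not_and, not_le] at hr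
    exact lt_of_le_of_lt (le_max_right _ _) (hr.2 hr.1.le)
  have hBlim : Tendsto B atTop (𝓝 0) := by
    have : B =ᶠ[atTop] fun _ => 0 := by
      filter_upwards [eventually_gt_atTop b] with r hr
      simp [hB, hLb r hr]
    exact (tendsto_congr' this).2 tendsto_const_nhds
  have hBcont : ContinuousWithinAt B (Ici z) z :=
    ((hBd z (by linarith)).continuousAt).continuousWithinAt
  have step3 : ∫ r in Ioi z, B' r = -B z := by
    rw [integral_Ioi_of_hasDerivAt_of_tendsto hBcont (fun r hr => hBd r (by
      have : z < r := hr; linarith)) iB' hBlim]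
    ring
  have e34 : (∫ r in Ioi z, 2 * ψ r / (1 + r)) + ∫ r in Ioi z, 2 * L r / (1 + r) ^ 2 =
      2 * L z / (1 + z) := by
    have i3 : IntegrableOn (fun r => 2 * ψ r / (1 + r)) (Ioi z) := by
      have : (fun r => 2 * ψ r / (1 + r)) = fun r => -(B' r + 2 * L r / (1 + r) ^ 2) := by
        funext r; simp only [hB']; ring
      rw [this]
      refine (iB'.add ?_).neg
      have h1 : IntegrableOn (fun r => 2 * L r / (1 + r) ^ 2) (Icc z (max z b)) := by
        refine ContinuousOn.integrableOn_compact isCompact_Icc ?_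
        refine (continuousOn_const.mul hLc.continuousOn).div (by fun_prop) fun r hr => ?_
        have : (0 : ℝ) ≤ r := hz.trans hr.1
        positivity
      refine h1.of_forall_sdiff_eq_zero measurableSet_Ioi fun r hr => ?_
      simp only [Set.mem_sdiff, mem_Ioi, mem_Icc, not_and, not_le] at hr
      simp [hLb r (lt_of_le_of_lt (le_max_right _ _) (hr.2 hr.1.le))]
    have i4 : IntegrableOn (fun r => 2 * L r / (1 + r) ^ 2) (Ioi z) := by
      have : (fun r => 2 * L r / (1 + r) ^ 2) = fun r => c * ℓ r := by
        funext r; simp only [hℓ]; field_simp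
      rw [this]
      exact iℓ.const_mul c
    rw [← integral_add i3 i4]
    have : ∫ r in Ioi z, (2 * ψ r / (1 + r) + 2 * L r / (1 + r) ^ 2) = ∫ r in Ioi z, -B' r := by
      refine setIntegral_congr_fun measurableSet_Ioi fun r _ => ?_
      simp only [hB']
      ring
    rw [this, integral_neg, step3]
    simp [hB]
  -- conclude
  rw [step1, e1, e2, e3, e4]
  linarith [e34]

/-- **(L12L) at the origin**: `L₁₂(𝓛_Γ f)(0) = −L₁₂(f)(0)` — the evolution of the codimension-one
quantity `L₁₂(·)(0)` under the linearised fundamental model is closed (Elgindi–Ghoul–Masmoudi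
2021, §5: the identity `L₁₂𝓛_{F_*} = 𝓛L₁₂` propagates `L₁₂(ε)(0) = 0`). [cite: Elgindi2021, §5 Lemma 5.3 (L12L) (p. 15 of arXiv:1904.04795)] -/
theorem L12_opLΓ_zero {α : ℝ} (hα : 0 ≤ α) {f : ℝ → ℝ → ℝ} (hf : ContDiff ℝ 1 (uncurry f))
    (hs : HasCompactSupport (uncurry f)) (hsub : tsupport (uncurry f) ⊆ strip) :
    L12 (opLΓ α f) 0 = -L12 f 0 := by
  rw [L12_opLΓ hα hf hs hsub le_rfl]
  ring

end Elgindi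

end Literature.Analysis.FluidPDE
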